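import Summits.Ventures.PercRepro.RankLevelSetRuleQSliceDiagRec
import Summits.Ventures.PercRepro.RankLevelSetRuleQSliceNegAll

/-!
# PercRepro — TOOLS FOR THE POLYNOMIAL THRESHOLD OF THE NEGATIVE HALF: THE FOUR-PART BOUND ON `R̂` AND THE GEOMETRIC
DOMINATION OF THE UNTRUNCATED TERMS (night-1, gen 20; dossier §31.7)

For `q = m + u` on a slice `3 ≤ u ≤ k − 1`, writing `n = u + k` and `S_j(Q, m) = Σ_{a ≤ m} C(m, a)/C(Q+j+a, a+j)`,
`D_j(Q) = S_j(Q, Q)`: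
* `mhat_eq_choose_of_le_sub` — on a slice `q − m ≥ j` the swap count is the binomial `C(q+j+a, a+j)` (Vandermonde);
  `mhat_ge_choose_t` — on a slice `q − m ≥ t` and `j ≥ t`, `m̂ ≥ C(q+a, a+t)`;
* **`rhat_le_four_parts`** — `R̂(m+u, k, m) ≤ n·S₁(q, m) + C(n, 2)·S₂(q, m) + Σ_{3 ≤ j ≤ u} C(n, j)·S_j(q, m)
  + (Σ_{u < j < k} C(n, j))·D_u(m)`;
* **`term_rec_le`** — the weighted diagonal terms `t_j = C(n, j)·D_j(q)` satisfy `t_{j+2} ≤ (t_j + t_{j+1})/8` for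
  `j ≥ 3` as soon as `n² ≤ q` (the three-term recurrence `slice_diag_rec` with `C(n, j+2)(j+2)(j+1) ≤ n²·C(n, j)`);
* **`slice_geom_dominated`** — such a sequence has `Σ_{i < N} t_{i+3} ≤ 2t₃ + 4t₄` (`t_j ≤ (8t₃ + 16t₄)/2^j`, a geometric sum).
Used by RankLevelSetRuleQSliceNegPoly. Axioms: standard.
-/

namespace PercRepro

open Finset

/-! ### §1 The untruncated swap counts, and the partial row sums -/

/-- On a slice `q − m ≥ j` the swap count is the plain binomial: `m̂(q, m; a, j) = C(q+j+a, a+j)` (Vandermonde). -/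
lemma mhat_eq_choose_of_le_sub (q m a j : ℕ) (hj : j ≤ q - m) : mhat q m a j = (q + j + a).choose (a + j) := by
  rw [mhat_eq, min_eq_left hj, sum_choose_mul_choose_add (q + a) a j, show q + a + j = q + j + a by ring]

/-- `Σ_{i < N} C(n, s + i) ≤ 2^n` for `s + N ≤ n + 1` (a partial row sum). -/
lemma sum_choose_shift_le_two_pow (n s N : ℕ) (hN : s + N ≤ n + 1) :
    ∑ i ∈ range N, (n.choose (s + i) : ℚ) ≤ (2 : ℚ) ^ n := by
  have hsplit := Finset.sum_range_add (fun i => n.choose i) s N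
  have hsub : ∑ i ∈ range (s + N), n.choose i ≤ ∑ i ∈ range (n + 1), n.choose i :=
    Finset.sum_le_sum_of_subset_of_nonneg (Finset.range_mono hN) (fun _ _ _ => Nat.zero_le _)
  rw [Nat.sum_range_choose] at hsub
  have h' : ∑ i ∈ range N, n.choose (s + i) ≤ 2 ^ n := by
    calc ∑ i ∈ range N, n.choose (s + i)
        ≤ ∑ i ∈ range s, n.choose i + ∑ i ∈ range N, n.choose (s + i) := Nat.le_add_left _ _
      _ = ∑ i ∈ range (s + N), n.choose i := hsplit.symm
      _ ≤ 2 ^ n := hsub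
  exact_mod_cast h'

/-! ### §2 Geometric domination of the untruncated terms -/

/-- **Geometric domination**: a nonnegative sequence with `t_{j+2} ≤ (t_j + t_{j+1})/8` for `j ≥ 3` has
`Σ_{i < N} t_{i+3} ≤ 2·t₃ + 4·t₄`. -/
lemma slice_geom_dominated (t : ℕ → ℚ) (ht : ∀ j, 0 ≤ t j) (hrec : ∀ j, 3 ≤ j → t (j + 2) ≤ (t j + t (j + 1)) / 8) (N : ℕ) :
    ∑ i ∈ range N, t (i + 3) ≤ 2 * t 3 + 4 * t 4 := by
  set c := 8 * t 3 + 16 * t 4 with hc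
  have hc0 : 0 ≤ c := by rw [hc]; linarith [ht 3, ht 4]
  -- pointwise: t j ≤ c / 2^j for j ≥ 3 (two-step induction)
  have hpt : ∀ j, 3 ≤ j → t j ≤ c / 2 ^ j ∧ t (j + 1) ≤ c / 2 ^ (j + 1) := by
    intro j hj
    induction j, hj using Nat.le_induction with
    | base =>
      constructor
      · rw [le_div_iff₀ (by positivity)]; norm_num; linarith [ht 4]
      · rw [le_div_iff₀ (by positivity)]; norm_num; linarith [ht 3]
    | succ j hj ih =>
      obtain ⟨h1, h2⟩ := ih
      refine ⟨h2, ?_⟩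
      have h3 := hrec j hj
      have hpow : c / 2 ^ (j + 1 + 1) = (c / 2 ^ j + c / 2 ^ (j + 1)) / 8 + c / 2 ^ (j + 1 + 1) / 4 := by
        field_simp
        ring
      have hnn : 0 ≤ c / 2 ^ (j + 1 + 1) / 4 := by positivity
      calc t (j + 1 + 1) ≤ (t j + t (j + 1)) / 8 := h3
        _ ≤ (c / 2 ^ j + c / 2 ^ (j + 1)) / 8 := by linarith
        _ ≤ c / 2 ^ (j + 1 + 1) := by rw [hpow]; linarith
  have hgeom : ∑ i ∈ range N, (1 / 2 : ℚ) ^ (i + 3) ≤ 1 / 4 := by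
    have h := geom_sum_Ico_le_of_lt_one (x := (1 / 2 : ℚ)) (m := 3) (n := N + 3) (by norm_num) (by norm_num)
    rw [Finset.sum_Ico_eq_sum_range, show N + 3 - 3 = N by omega] at h
    have hre : ∑ i ∈ range N, (1 / 2 : ℚ) ^ (i + 3) = ∑ i ∈ range N, (1 / 2 : ℚ) ^ (3 + i) :=
      Finset.sum_congr rfl (fun i _ => by rw [Nat.add_comm])
    rw [hre]
    calc ∑ i ∈ range N, (1 / 2 : ℚ) ^ (3 + i) ≤ (1 / 2 : ℚ) ^ 3 / (1 - 1 / 2) := h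
      _ = 1 / 4 := by norm_num
  calc ∑ i ∈ range N, t (i + 3) ≤ ∑ i ∈ range N, c * (1 / 2 : ℚ) ^ (i + 3) := by
        refine Finset.sum_le_sum (fun i _ => ?_)
        have := (hpt (i + 3) (by omega)).1
        rw [div_eq_mul_one_div, ← one_div_pow] at this
        exact this
    _ = c * ∑ i ∈ range N, (1 / 2 : ℚ) ^ (i + 3) := by rw [Finset.mul_sum]
    _ ≤ c * (1 / 4) := mul_le_mul_of_nonneg_left hgeom hc0
    _ = 2 * t 3 + 4 * t 4 := by rw [hc]; ring

/-- **The weighted diagonal terms are geometrically dominated**: for `t_j = C(n, j)·D_j(q)` and `n² ≤ q`,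
`t_{j+2} ≤ (t_j + t_{j+1})/8` for every `j ≥ 3` (the three-term recurrence `slice_diag_rec` and
`C(n, j+2)(j+2)(j+1) ≤ n²·C(n, j)`, `C(n, j+2)(j+2) ≤ n·C(n, j+1)`). -/
lemma term_rec_le (n q j : ℕ) (hq : n ^ 2 ≤ q) (hj : 3 ≤ j) :
    (n.choose (j + 2) : ℚ) * ∑ a ∈ range (q + 1), (q.choose a : ℚ) / ((q + (j + 2) + a).choose (a + (j + 2)) : ℚ)
      ≤ ((n.choose j : ℚ) * ∑ a ∈ range (q + 1), (q.choose a : ℚ) / ((q + j + a).choose (a + j) : ℚ)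
          + (n.choose (j + 1) : ℚ) * ∑ a ∈ range (q + 1), (q.choose a : ℚ) / ((q + (j + 1) + a).choose (a + (j + 1)) : ℚ))
        / 8 := by
  have hrec := slice_diag_rec q j
  set D0 := ∑ a ∈ range (q + 1), (q.choose a : ℚ) / ((q + j + a).choose (a + j) : ℚ) with hD0
  set D1 := ∑ a ∈ range (q + 1), (q.choose a : ℚ) / ((q + (j + 1) + a).choose (a + (j + 1)) : ℚ) with hD1
  set D2 := ∑ a ∈ range (q + 1), (q.choose a : ℚ) / ((q + (j + 2) + a).choose (a + (j + 2)) : ℚ) with hD2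
  have hD00 : 0 ≤ D0 := Finset.sum_nonneg (fun a _ => by positivity)
  have hD10 : 0 ≤ D1 := Finset.sum_nonneg (fun a _ => by positivity)
  have hD20 : 0 ≤ D2 := Finset.sum_nonneg (fun a _ => by positivity)
  -- the binomial relations in ℕ: C(n, j+2)(j+2) ≤ n·C(n, j+1), C(n, j+1)(j+1) ≤ n·C(n, j)
  have hb1 : n.choose (j + 2) * (j + 2) ≤ n * n.choose (j + 1) := by
    rw [Nat.choose_succ_right_eq n (j + 1)]
    exact Nat.mul_le_mul_left _ (Nat.sub_le _ _) |>.trans (by rw [Nat.mul_comm])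
  have hb2 : n.choose (j + 1) * (j + 1) ≤ n * n.choose j := by
    rw [Nat.choose_succ_right_eq n j]
    exact Nat.mul_le_mul_left _ (Nat.sub_le _ _) |>.trans (by rw [Nat.mul_comm])
  have hb1' : (n.choose (j + 2) : ℚ) * ((j : ℚ) + 2) ≤ (n : ℚ) * (n.choose (j + 1) : ℚ) := by exact_mod_cast hb1
  have hb2' : (n.choose (j + 1) : ℚ) * ((j : ℚ) + 1) ≤ (n : ℚ) * (n.choose j : ℚ) := by exact_mod_cast hb2
  have hq' : ((n : ℚ)) ^ 2 ≤ q := by exact_mod_cast hq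
  have hn0 : (0 : ℚ) ≤ n := by positivity
  -- (2q + j + 2)(j + 2)·t_{j+2} = C(n,j+2)(j+2)·[(j+1) D0 + D1] ≤ n² t_j + n t_{j+1}
  have key : (2 * (q : ℚ) + j + 2) * ((j : ℚ) + 2) * ((n.choose (j + 2) : ℚ) * D2)
      ≤ (n : ℚ) ^ 2 * ((n.choose j : ℚ) * D0) + (n : ℚ) * ((n.choose (j + 1) : ℚ) * D1) := by
    have e : (2 * (q : ℚ) + j + 2) * ((j : ℚ) + 2) * ((n.choose (j + 2) : ℚ) * D2)
        = ((n.choose (j + 2) : ℚ) * ((j : ℚ) + 2)) * (((j : ℚ) + 1) * D0 + D1) := by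
      rw [← hrec]; ring
    rw [e]
    have c1 : ((n.choose (j + 2) : ℚ) * ((j : ℚ) + 2)) * (((j : ℚ) + 1) * D0)
        ≤ (n : ℚ) ^ 2 * ((n.choose j : ℚ) * D0) := by
      have : ((n.choose (j + 2) : ℚ) * ((j : ℚ) + 2)) * ((j : ℚ) + 1) ≤ (n : ℚ) ^ 2 * (n.choose j : ℚ) := by
        calc ((n.choose (j + 2) : ℚ) * ((j : ℚ) + 2)) * ((j : ℚ) + 1)
            ≤ ((n : ℚ) * (n.choose (j + 1) : ℚ)) * ((j : ℚ) + 1) := mul_le_mul_of_nonneg_right hb1' (by positivity)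
          _ = (n : ℚ) * ((n.choose (j + 1) : ℚ) * ((j : ℚ) + 1)) := by ring
          _ ≤ (n : ℚ) * ((n : ℚ) * (n.choose j : ℚ)) := mul_le_mul_of_nonneg_left hb2' hn0
          _ = (n : ℚ) ^ 2 * (n.choose j : ℚ) := by ring
      calc ((n.choose (j + 2) : ℚ) * ((j : ℚ) + 2)) * (((j : ℚ) + 1) * D0)
          = (((n.choose (j + 2) : ℚ) * ((j : ℚ) + 2)) * ((j : ℚ) + 1)) * D0 := by ring
        _ ≤ ((n : ℚ) ^ 2 * (n.choose j : ℚ)) * D0 := mul_le_mul_of_nonneg_right this hD00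
        _ = (n : ℚ) ^ 2 * ((n.choose j : ℚ) * D0) := by ring
    have c2 : ((n.choose (j + 2) : ℚ) * ((j : ℚ) + 2)) * D1 ≤ (n : ℚ) * ((n.choose (j + 1) : ℚ) * D1) := by
      calc ((n.choose (j + 2) : ℚ) * ((j : ℚ) + 2)) * D1 ≤ ((n : ℚ) * (n.choose (j + 1) : ℚ)) * D1 :=
            mul_le_mul_of_nonneg_right hb1' hD10
        _ = (n : ℚ) * ((n.choose (j + 1) : ℚ) * D1) := by ring
    linarith [c1, c2]
  -- (2q + j + 2)(j + 2) ≥ 10 q and n² ≤ q, n ≤ n² (n ≥ 1 or n = 0)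
  have hT0 : 0 ≤ (n.choose (j + 2) : ℚ) * D2 := by positivity
  have hj' : (3 : ℚ) ≤ j := by exact_mod_cast hj
  have hbig : 10 * (q : ℚ) * ((n.choose (j + 2) : ℚ) * D2) ≤ (2 * (q : ℚ) + j + 2) * ((j : ℚ) + 2) * ((n.choose (j + 2) : ℚ) * D2) := by
    apply mul_le_mul_of_nonneg_right _ hT0
    nlinarith [Nat.cast_nonneg (α := ℚ) q]
  rw [le_div_iff₀ (by norm_num)]
  rcases Nat.eq_zero_or_pos n with hn | hn
  swap
  · have hn1 : (1 : ℚ) ≤ n := by exact_mod_cast hn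
    have hnn : (n : ℚ) ≤ (n : ℚ) ^ 2 := by nlinarith
    have hT1 : 0 ≤ (n.choose (j + 1) : ℚ) * D1 := by positivity
    have hT00 : 0 ≤ (n.choose j : ℚ) * D0 := by positivity
    have : (n : ℚ) ^ 2 * ((n.choose j : ℚ) * D0) + (n : ℚ) * ((n.choose (j + 1) : ℚ) * D1)
        ≤ (n : ℚ) ^ 2 * ((n.choose j : ℚ) * D0 + (n.choose (j + 1) : ℚ) * D1) := by
      nlinarith [mul_le_mul_of_nonneg_right hnn hT1]
    have hqq : (n : ℚ) ^ 2 * ((n.choose j : ℚ) * D0 + (n.choose (j + 1) : ℚ) * D1)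
        ≤ (q : ℚ) * ((n.choose j : ℚ) * D0 + (n.choose (j + 1) : ℚ) * D1) :=
      mul_le_mul_of_nonneg_right hq' (by positivity)
    have hq0 : (0 : ℚ) < q := by nlinarith [hq', hn1]
    have h10 : (q : ℚ) * (10 * ((n.choose (j + 2) : ℚ) * D2))
        ≤ (q : ℚ) * ((n.choose j : ℚ) * D0 + (n.choose (j + 1) : ℚ) * D1) := by
      linarith [hbig, key, this, hqq]
    have h10' := le_of_mul_le_mul_left h10 hq0
    linarith
  · subst hn
    simp only [Nat.choose_eq_zero_of_lt (by omega : 0 < j + 2), Nat.cast_zero, zero_mul]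
    positivity

/-! ### §3 The four-part bound on `R̂` on a slice `u ≥ 3` -/

/-- On a slice `q − m ≥ t`, `m̂(q, m; a, j) ≥ C(q+a, a+t)` for every `j ≥ t` (the `tD = t` term of `mhat_eq`). -/
lemma mhat_ge_choose_t (q m a j t : ℕ) (ht : t ≤ j) (hu : t ≤ q - m) :
    (q + a).choose (a + t) ≤ mhat q m a j := by
  rw [mhat_eq]
  have h3 : t ∈ range (min j (q - m) + 1) := by rw [Finset.mem_range]; omega
  calc (q + a).choose (a + t) = 1 * (q + a).choose (a + t) := (one_mul _).symm
    _ ≤ j.choose t * (q + a).choose (a + t) := Nat.mul_le_mul_right _ (Nat.choose_pos ht)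
    _ ≤ ∑ tD ∈ range (min j (q - m) + 1), j.choose tD * (q + a).choose (a + tD) :=
        Finset.single_le_sum (f := fun tD => j.choose tD * (q + a).choose (a + tD)) (fun i _ => Nat.zero_le _) h3

/-- **The four-part bound on `R̂(m+u, k, m)`** on a slice `3 ≤ u ≤ k − 1`:
`R̂ ≤ (u+k)·S₁(q, m) + C(u+k, 2)·S₂(q, m) + Σ_{i < u−2} C(u+k, i+3)·S_{i+3}(q, m) + (Σ_{i < k−1−u} C(u+k, u+1+i))·S_u(m, m)`,
`q = m + u` — the untruncated terms `j ≤ u` exactly (`mhat_eq_choose_of_le_sub`), the truncated ones `j > u` through their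
`tD = u` swap term (`S_u(m, m)` is the diagonal slice sum `D_u(m)`). -/
lemma rhat_le_four_parts (k m u : ℕ) (hu : 3 ≤ u) (huk : u + 1 ≤ k) :
    rhat (m + u) k m
      ≤ ((u + k : ℕ) : ℚ) * ∑ a ∈ range (m + 1), (m.choose a : ℚ) / ((m + u + 1 + a).choose (a + 1) : ℚ)
        + ((u + k).choose 2 : ℚ) * ∑ a ∈ range (m + 1), (m.choose a : ℚ) / ((m + u + 2 + a).choose (a + 2) : ℚ)
        + ∑ i ∈ range (u - 2), ((u + k).choose (i + 3) : ℚ)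
            * ∑ a ∈ range (m + 1), (m.choose a : ℚ) / ((m + u + (i + 3) + a).choose (a + (i + 3)) : ℚ)
        + (∑ i ∈ range (k - 1 - u), ((u + k).choose (u + 1 + i) : ℚ))
            * ∑ a ∈ range (m + 1), (m.choose a : ℚ) / ((m + u + a).choose (a + u) : ℚ) := by
  unfold rhat
  rw [sum_Ioo_nat, show k - (0 + 1) = u + (k - 1 - u) by omega, Finset.sum_range_add,
    show u = 2 + (u - 2) by omega, Finset.sum_range_add, Finset.sum_range_succ, Finset.sum_range_one,
    show 2 + (u - 2) = u by omega]
  simp only [zero_add, show m + u + k - m = u + k by omega]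
  have hmj : ∀ j, j ≤ u → ∀ a, mhat (m + u) m a j = (m + u + j + a).choose (a + j) := fun j hj a =>
    mhat_eq_choose_of_le_sub (m + u) m a j (by omega)
  have hmt : ∀ j, u ≤ j → ∀ a, (m + u + a).choose (a + u) ≤ mhat (m + u) m a j := fun j hj a =>
    mhat_ge_choose_t (m + u) m a j u hj (by omega)
  -- j = 1 and j = 2
  have e1 : ∑ a ∈ range (m + 1), ((m.choose a * (u + k).choose 1 : ℕ) : ℚ) / (mhat (m + u) m a 1 : ℚ)
      = ((u + k : ℕ) : ℚ) * ∑ a ∈ range (m + 1), (m.choose a : ℚ) / ((m + u + 1 + a).choose (a + 1) : ℚ) := by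
    rw [Finset.mul_sum]
    refine Finset.sum_congr rfl (fun a _ => ?_)
    rw [hmj 1 (by omega), Nat.choose_one_right]; push_cast; ring
  have e2 : ∑ a ∈ range (m + 1), ((m.choose a * (u + k).choose (1 + 1) : ℕ) : ℚ) / (mhat (m + u) m a (1 + 1) : ℚ)
      = ((u + k).choose 2 : ℚ) * ∑ a ∈ range (m + 1), (m.choose a : ℚ) / ((m + u + 2 + a).choose (a + 2) : ℚ) := by
    rw [Finset.mul_sum]
    refine Finset.sum_congr rfl (fun a _ => ?_)
    rw [show (1 : ℕ) + 1 = 2 from rfl, hmj 2 (by omega)]; push_cast; ring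
  -- 3 ≤ j ≤ u
  have e3 : ∑ i ∈ range (u - 2), ∑ a ∈ range (m + 1),
        ((m.choose a * (u + k).choose (1 + (2 + i)) : ℕ) : ℚ) / (mhat (m + u) m a (1 + (2 + i)) : ℚ)
      = ∑ i ∈ range (u - 2), ((u + k).choose (i + 3) : ℚ)
          * ∑ a ∈ range (m + 1), (m.choose a : ℚ) / ((m + u + (i + 3) + a).choose (a + (i + 3)) : ℚ) := by
    refine Finset.sum_congr rfl (fun i hi => ?_)
    rw [Finset.mem_range] at hi
    rw [Finset.mul_sum]
    refine Finset.sum_congr rfl (fun a _ => ?_)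
    rw [show 1 + (2 + i) = i + 3 by ring, hmj (i + 3) (by omega)]; push_cast; ring
  -- j > u
  have e4 : ∑ i ∈ range (k - 1 - u), ∑ a ∈ range (m + 1),
        ((m.choose a * (u + k).choose (1 + (u + i)) : ℕ) : ℚ) / (mhat (m + u) m a (1 + (u + i)) : ℚ)
      ≤ (∑ i ∈ range (k - 1 - u), ((u + k).choose (u + 1 + i) : ℚ))
          * ∑ a ∈ range (m + 1), (m.choose a : ℚ) / ((m + u + a).choose (a + u) : ℚ) := by
    rw [Finset.sum_mul]
    refine Finset.sum_le_sum (fun i _ => ?_)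
    rw [Finset.mul_sum]
    refine Finset.sum_le_sum (fun a _ => ?_)
    rw [show 1 + (u + i) = u + 1 + i by ring]
    have hb := hmt (u + 1 + i) (by omega) a
    have hpos : (0 : ℚ) < ((m + u + a).choose (a + u) : ℚ) := by exact_mod_cast Nat.choose_pos (by omega)
    rw [show ((m.choose a * (u + k).choose (u + 1 + i) : ℕ) : ℚ) / (mhat (m + u) m a (u + 1 + i) : ℚ)
        = ((u + k).choose (u + 1 + i) : ℚ) * ((m.choose a : ℚ) / (mhat (m + u) m a (u + 1 + i) : ℚ)) by push_cast; ring]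
    apply mul_le_mul_of_nonneg_left _ (by positivity)
    apply div_le_div_of_nonneg_left (by positivity) hpos
    exact_mod_cast hb
  rw [e1, e2, e3, Nat.add_sub_cancel_left]
  linarith [e4]

end PercRepro
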